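import Summits.RiemannHypothesis.RiemannHypothesis.Theorems.SignConeConeMagnificationCaraConverse
import Summits.RiemannHypothesis.RiemannHypothesis.Theorems.SignConeConeMagnificationStubFakePNT
import Summits.RiemannHypothesis.RiemannHypothesis.Theorems.SignConeConeMagnificationStubChebyshev
import Summits.RiemannHypothesis.RiemannHypothesis.Theorems.SignConeConeMagnificationStubContinuation
import Summits.RiemannHypothesis.RiemannHypothesis.Theorems.SignConeConeMagnificationStubPdLaplace
import Summits.RiemannHypothesis.RiemannHypothesis.Theorems.SignConeConeMagnificationStubCara
import HarnessLib

/-!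
# The unit-slack cone IS the Carathéodory class; the crux `ConeMagnification` in Dirichlet-series form

Sub-problem `RiemannHypothesis`, route `SignCone`, crux `ConeMagnification` (stmt-RiemannHypothesis-16303),
seat 0, session 9.

* `unitSlack_iff_cara`: for a weight `c ≥ 0` on `ℕ` with `c(1) = 0`,
  (unit slack against every Weil test) ⟺ (`Σ c(n) n^{-σ} < ∞` for `σ > 1`) ∧ (some `F` holomorphic on
  `Re s > 1/2` equals `L_c − 1/(s−1)` on `Re s > 1` and satisfies the Carathéodory majorant
  `Re F(s) ≤ 1/2 + Re(1/s) + 𝒜(s) − ½log π`).  Forward: the landed chain `stub_fakePNT` → `stub_chebyshev` →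
  `stub_continuation`, `stub_pdLaplace` → `stub_cara` of the line `Sketch`; backward: `unitSlack_of_cara`
  (`…CaraConverse`, contour shift + Borel–Carathéodory + damping).
* `slack_of_cara m`: the `κ`-parametric converse — majorant constant `m/2` gives slack `m` (`m = 0`: Carathéodory
  with constant `0` ⟹ fake Weil positivity, the converse of `exactWeight_cara` of `SignConeExactConeRigidityCara`),
  by shifting the `n = 1` coefficient and applying `unitSlack_of_cara`.
* `coneMagnification_iff_caraRigidity`: the crux is EQUIVALENT to the rigidity statement for nonnegative
  Dirichlet series "`c ≥ 0`, `c(1) = 0`, `Σ c(n)n^{-σ} < ∞` (`σ > 1`), `L_c − 1/(s−1)` holomorphic on `Re s > 1/2`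
  with `Re (L_c − 1/(s−1)) ≤ 1/2 + Re(1/s) + 𝒜(s) − ½ log π` ⟹ RH" (slack-cone compactness
  `coneMagnification_iff_uniform` + the equivalence above).  In particular the hypothesis `hU` (unit slack) of the
  open stub `stub_designOfOffline` is implied by its hypotheses `hsum`, `hF` and may be dropped.

References: this route's `StubCara`, `Compactness`, `CaraConverse` files.
-/

noncomputable section

-- `Summit.RiemannHypothesis.RiemannHypothesis.…` repeats a namespace component by design (D-0017 layout).
set_option linter.dupNamespace false

open Complex MeasureTheory Set Metric LSeries Literature.NumberTheory.LFunctions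
open Summit.RiemannHypothesis.RiemannHypothesis.Cruxes.ConeMagnification.Sketch (stub_continuation)

namespace Summit.RiemannHypothesis.RiemannHypothesis.Theorems.SignConeConeMagnification

/-- **The unit-slack cone is the Carathéodory class**: for `c ≥ 0` with `c(1) = 0`, `c` has unit slack against
every Weil test iff `Σ c(n) n^{-σ} < ∞` for `σ > 1` and `L_c − 1/(s−1)` extends holomorphically to `Re s > 1/2`
with the Carathéodory majorant `Re ≤ 1/2 + Re(1/s) + 𝒜(s) − ½ log π`
(`𝒜(s) = (1/2π)∫ Re ψ(1/4+iv/2)·(σ−½)/((σ−½)²+(t−v)²) dv = ½Re ψ(s/2)`). [folklore] -/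
theorem unitSlack_iff_cara :
    ∀ c : ℕ → ℝ, (∀ n, 0 ≤ c n) → c 1 = 0 →
      ((∀ g : ℝ → ℂ, IsWeilTest g →
        -(∫ t, ‖g t‖ ^ 2) ≤
          (weilPolarTerm (weilConv g (weilReflect g)) + weilArchTerm (weilConv g (weilReflect g)) -
            ∑' n : ℕ, ((c n : ℝ) : ℂ) / (Real.sqrt n : ℂ) *
              (weilConv g (weilReflect g) (Real.log n) + weilConv g (weilReflect g) (-Real.log n))).re) ↔
      ((∀ σ : ℝ, 1 < σ → LSeriesSummable (fun n => ((c n : ℝ) : ℂ)) σ) ∧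
        ∃ F : ℂ → ℂ, DifferentiableOn ℂ F {s : ℂ | 1 / 2 < s.re} ∧
          (∀ s : ℂ, 1 < s.re → F s = LSeries (fun n => ((c n : ℝ) : ℂ)) s - 1 / (s - 1)) ∧
          ∀ s : ℂ, 1 / 2 < s.re →
            (F s).re ≤ 1 / 2 + (1 / s).re +
              1 / (2 * Real.pi) * (∫ v : ℝ, (Complex.digamma (1 / 4 + v / 2 * Complex.I)).re *
                ((s.re - 1 / 2) / ((s.re - 1 / 2) ^ 2 + (s.im - v) ^ 2))) - Real.log Real.pi / 2)) := by
  intro c hc0 hc1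
  constructor
  · intro hU
    have hPNT := stub_fakePNT c hc0 hU
    have hsum := stub_chebyshev c hc0 hPNT
    have hcont := stub_continuation c hc0 hPNT hsum
    have hPD := stub_pdLaplace c hc0 hU
    exact ⟨hsum, stub_cara c hc0 hc1 hU hsum hcont hPD⟩
  · rintro ⟨hsum, hF⟩
    exact unitSlack_of_cara c hsum hF

/-- **The crux in Dirichlet-series form**: `SignCone.ConeMagnification` is equivalent to the Carathéodory
rigidity statement — every weight `c ≥ 0` on `ℕ` with `c(1) = 0`, `Σ c(n) n^{-σ} < ∞` (`σ > 1`) and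
`L_c − 1/(s−1)` holomorphic on `Re s > 1/2` with `Re (L_c − 1/(s−1)) ≤ 1/2 + Re(1/s) + 𝒜(s) − ½log π` forces RH
(slack-cone compactness `coneMagnification_iff_uniform` and `unitSlack_iff_cara`). [folklore] -/
theorem coneMagnification_iff_caraRigidity :
    Summit.RiemannHypothesis.RiemannHypothesis.Theses.SignCone.ConeMagnification ↔
      (∀ c : ℕ → ℝ, (∀ n, 0 ≤ c n) → c 1 = 0 →
        (∀ σ : ℝ, 1 < σ → LSeriesSummable (fun n => ((c n : ℝ) : ℂ)) σ) →
        (∃ F : ℂ → ℂ, DifferentiableOn ℂ F {s : ℂ | 1 / 2 < s.re} ∧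
          (∀ s : ℂ, 1 < s.re → F s = LSeries (fun n => ((c n : ℝ) : ℂ)) s - 1 / (s - 1)) ∧
          ∀ s : ℂ, 1 / 2 < s.re →
            (F s).re ≤ 1 / 2 + (1 / s).re +
              1 / (2 * Real.pi) * (∫ v : ℝ, (Complex.digamma (1 / 4 + v / 2 * Complex.I)).re *
                ((s.re - 1 / 2) / ((s.re - 1 / 2) ^ 2 + (s.im - v) ^ 2))) - Real.log Real.pi / 2) →
        Summit.RiemannHypothesis) := by
  rw [SignCone.coneMagnification_iff_uniform]
  constructor
  · intro h c hc0 hc1 hsum hF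
    exact h ⟨c, hc0, hc1, unitSlack_of_cara c hsum hF⟩
  · rintro h ⟨c, hc0, hc1, hU⟩
    obtain ⟨hsum, hF⟩ := (unitSlack_iff_cara c hc0 hc1).1 hU
    exact h c hc0 hc1 hsum hF

/-! ### Slack `m`: the `κ`-parametric converse by shifting the `n = 1` coefficient -/

/-- **Carathéodory with constant `m/2` ⟹ slack `m`** (any real `m`; `m = 1`: unit slack, `m = 0`: fake Weil
positivity, the converse of `exactWeight_cara`): if `Σ|c(n)|n^{-σ} < ∞` (`σ > 1`) and some `F` holomorphic on
`Re s > 1/2` equals `L_c − 1/(s−1)` on `Re s > 1` with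
`Re F(s) ≤ m/2 + Re(1/s) + 𝒜(s) − ½ log π`, then `−m‖g‖₂² ≤ Re (W_ar(g⋆g̃) − Σₙ c(n) n^{-1/2}(G(log n) + G(−log n)))`
for every Weil test `g`.  Proof: apply `unitSlack_of_cara` to `c + ((1−m)/2)·𝟙_{n=1}`, whose `F` is `F + (1−m)/2` and
whose node sum exceeds that of `c` by `(1−m)‖g‖₂²`. [folklore] -/
theorem slack_of_cara :
    ∀ m : ℝ, ∀ c : ℕ → ℝ, (∀ σ : ℝ, 1 < σ → LSeriesSummable (fun n => ((c n : ℝ) : ℂ)) σ) →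
      (∃ F : ℂ → ℂ, DifferentiableOn ℂ F {s : ℂ | 1 / 2 < s.re} ∧
        (∀ s : ℂ, 1 < s.re → F s = LSeries (fun n => ((c n : ℝ) : ℂ)) s - 1 / (s - 1)) ∧
        ∀ s : ℂ, 1 / 2 < s.re →
          (F s).re ≤ m / 2 + (1 / s).re +
            1 / (2 * Real.pi) * (∫ v : ℝ, (Complex.digamma (1 / 4 + v / 2 * Complex.I)).re *
              ((s.re - 1 / 2) / ((s.re - 1 / 2) ^ 2 + (s.im - v) ^ 2))) - Real.log Real.pi / 2) →
      ∀ g : ℝ → ℂ, IsWeilTest g →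
        -(m * ∫ t, ‖g t‖ ^ 2) ≤
          (weilPolarTerm (weilConv g (weilReflect g)) + weilArchTerm (weilConv g (weilReflect g)) -
            ∑' n : ℕ, ((c n : ℝ) : ℂ) / (Real.sqrt n : ℂ) *
              (weilConv g (weilReflect g) (Real.log n) + weilConv g (weilReflect g) (-Real.log n))).re := by
  rintro m c hsum ⟨F, hFd, hFL, hFA⟩ g hg
  -- the shifted weight `c' = c + ((1-m)/2)·𝟙_{n=1}`
  set e : ℕ → ℝ := fun n => if n = 1 then (1 - m) / 2 else 0 with he
  set c' : ℕ → ℝ := fun n => c n + e n with hc'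
  have he0 : ∀ n, n ≠ 1 → e n = 0 := fun n hn => by simp [he, hn]
  have hcast : (fun n => ((c' n : ℝ) : ℂ)) = (fun n => ((c n : ℝ) : ℂ)) + fun n => ((e n : ℝ) : ℂ) := by
    funext n; simp [hc']
  have heS : ∀ s : ℂ, LSeriesSummable (fun n => ((e n : ℝ) : ℂ)) s := fun s => by
    refine summable_of_ne_finset_zero (s := {1}) fun n hn => ?_
    rw [Finset.mem_singleton] at hn
    rcases eq_or_ne n 0 with rfl | h0
    · simp [term]
    · simp [term_of_ne_zero h0, he0 n hn]
  have heL : ∀ s : ℂ, LSeries (fun n => ((e n : ℝ) : ℂ)) s = (((1 - m) / 2 : ℝ) : ℂ) := fun s => by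
    rw [LSeries, tsum_eq_single 1 fun n hn => ?_]
    · simp [he]
    · rcases eq_or_ne n 0 with rfl | h0
      · simp [term]
      · simp [term_of_ne_zero h0, he0 n hn]
  have hsum' : ∀ σ : ℝ, 1 < σ → LSeriesSummable (fun n => ((c' n : ℝ) : ℂ)) σ := fun σ hσ => by
    rw [hcast]; exact (hsum σ hσ).add (heS _)
  have hF' : ∃ F' : ℂ → ℂ, DifferentiableOn ℂ F' {s : ℂ | 1 / 2 < s.re} ∧
      (∀ s : ℂ, 1 < s.re → F' s = LSeries (fun n => ((c' n : ℝ) : ℂ)) s - 1 / (s - 1)) ∧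
      ∀ s : ℂ, 1 / 2 < s.re →
        (F' s).re ≤ 1 / 2 + (1 / s).re +
          1 / (2 * Real.pi) * (∫ v : ℝ, (Complex.digamma (1 / 4 + v / 2 * Complex.I)).re *
            ((s.re - 1 / 2) / ((s.re - 1 / 2) ^ 2 + (s.im - v) ^ 2))) - Real.log Real.pi / 2 := by
    refine ⟨fun s => F s + (((1 - m) / 2 : ℝ) : ℂ), hFd.add_const _, fun s hs => ?_, fun s hs => ?_⟩
    · show F s + _ = _
      have hcs : LSeriesSummable (fun n => ((c n : ℝ) : ℂ)) s :=
        (hsum s.re hs).of_re_le_re (by simp)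
      rw [hFL s hs, hcast, LSeries_add hcs (heS s), heL]
      ring
    · have h := hFA s hs
      simp only [add_re, ofReal_re]
      linarith
  have hU := unitSlack_of_cara c' hsum' hF' g hg
  -- compare the node sums of `c'` and `c`
  set G := weilConv g (weilReflect g) with hGdef
  have hG : IsWeilTest G := hg.weilConv hg.weilReflect
  obtain ⟨R, hR⟩ := hG.2.isCompact.isBounded.subset_closedBall 0
  set N : ℕ := ⌈Real.exp R⌉₊ + 1 with hN
  have hvan : ∀ n : ℕ, N ≤ n → G (Real.log n) = 0 ∧ G (-Real.log n) = 0 := by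
    intro n hn
    have hn1 : (1 : ℝ) ≤ n := by
      have : 1 ≤ N := by simp [hN]
      exact_mod_cast this.trans hn
    have hlog : R < Real.log n := by
      rw [Real.lt_log_iff_exp_lt (by linarith)]
      have h2 : Real.exp R ≤ ⌈Real.exp R⌉₊ := Nat.le_ceil _
      have h3 : ((⌈Real.exp R⌉₊ : ℕ) : ℝ) + 1 ≤ n := by
        have : N ≤ n := hn
        simp only [hN] at this
        exact_mod_cast this
      linarith
    constructor <;> apply image_eq_zero_of_notMem_tsupport <;> intro hmem <;>
      have h1 := hR hmem <;>
      rw [mem_closedBall, dist_zero_right, Real.norm_eq_abs] at h1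
    · have : Real.log n ≤ R := (le_abs_self _).trans h1
      linarith
    · rw [abs_neg] at h1
      have : Real.log n ≤ R := (le_abs_self _).trans h1
      linarith
  have hsumc : ∀ d : ℕ → ℝ, Summable fun n : ℕ => ((d n : ℝ) : ℂ) / (Real.sqrt n : ℂ) *
      (G (Real.log n) + G (-Real.log n)) := fun d =>
    summable_of_ne_finset_zero (s := Finset.range N) fun n hn => by
      obtain ⟨h1, h2⟩ := hvan n (by simpa using hn)
      simp [h1, h2]
  have hsplit : (∑' n : ℕ, ((c' n : ℝ) : ℂ) / (Real.sqrt n : ℂ) * (G (Real.log n) + G (-Real.log n))) =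
      (∑' n : ℕ, ((c n : ℝ) : ℂ) / (Real.sqrt n : ℂ) * (G (Real.log n) + G (-Real.log n))) +
        (((1 - m) : ℝ) : ℂ) * G 0 := by
    have e1 : (∑' n : ℕ, ((e n : ℝ) : ℂ) / (Real.sqrt n : ℂ) * (G (Real.log n) + G (-Real.log n))) =
        (((1 - m) : ℝ) : ℂ) * G 0 := by
      rw [tsum_eq_single 1 fun n hn => by simp [he0 n hn]]
      simp [he]
      ring
    rw [← e1, ← (hsumc c).tsum_add (hsumc e)]
    refine tsum_congr fun n => ?_
    simp only [hc']
    push_cast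
    ring
  rw [hsplit] at hU
  rw [hGdef, weilConv_weilReflect_apply_zero] at hU
  simp only [sub_re, add_re, ← ofReal_mul, ofReal_re] at hU ⊢
  linarith

end Summit.RiemannHypothesis.RiemannHypothesis.Theorems.SignConeConeMagnification

end
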